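import Literature.IUT.LogThetaLattice.GlobalFrobenioidModelsData
import Literature.IUT.LogThetaLattice.GlobalPacketsLGPProofs
import Literature.AlgebraicGeometry.Frobenioids.ArithmeticDivisors
import HarnessLib

/-!
# [IUTchIII] Proposition 3.7 (i)(ii): the number field `(†𝕄⊛_MOD)_α` and the fractional-ideal Frobenioid
# `(†𝓕⊛_𝔪𝔬𝔡)_α` at the places of a number field, with its natural isomorphism to `(†𝓕⊛_mod)_α` (model form)

abc-iut cell, layer L6, D-0067 wave-4 discharge seat abc-iut-w4-d005 (board row F10-a = [IUTchIII] Prop. 3.7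
(i)(ii) construction clauses; nodes IUTchIII:Prop3.7(i), IUTchIII:Prop3.7(ii)). S. Mochizuki, *Inter-universal
Teichmüller Theory III*, kurims manuscript (May 2020), Proposition 3.7 (i)(ii) pp. 109–110, Example 3.6 (i)(ii)
pp. 107–108 [claim key Mochizuki2012, status disputed (D-0012)]; S. Mochizuki, *The geometry of Frobenioids I*,
Example 6.3 p. 113 [cite: MochizukiFrdI2008, Ex. 6.3 p.113].

What is printed. Prop. 3.7 (i): "For each `α ∈ A`, there is an algorithm for constructing, as discussed in
Example 3.6, (i), from the [number] field given by the image `(†𝕄⊛_MOD)_α` of the composite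
`(†𝕄⊛_mod)_α → (†𝕄⊛_mod)_A → log(^A𝓕_{𝕍_ℚ})` of the homomorphisms of Proposition 3.3, (i), (ii), a Frobenioid
`(†𝓕⊛_MOD)_α`, together with a natural isomorphism of Frobenioids `(†𝓕⊛_mod)_α ⥲ (†𝓕⊛_MOD)_α` … that induces the
tautological isomorphism `(†𝕄⊛_mod)_α ⥲ (†𝕄⊛_MOD)_α` on the associated rational function monoids". (ii): "… from
the [number] field `(†𝕄⊛_𝔪𝔬𝔡)_α := (†𝕄⊛_MOD)_α` and the Galois invariants of the local monoids … — i.e., so the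
corresponding local 'fractional ideal `𝔍_v`' of Example 3.6, (ii), is a subset [indeed a submodule when
`v ∈ 𝕍^non`] of `𝓘^ℚ(^{A,α}𝓕_v)` … — a Frobenioid `(†𝓕⊛_𝔪𝔬𝔡)_α`, together with natural isomorphisms of Frobenioids
`(†𝓕⊛_mod)_α ⥲ (†𝓕⊛_𝔪𝔬𝔡)_α`; `(†𝓕⊛_𝔪𝔬𝔡)_α ⥲ (†𝓕⊛_MOD)_α` that induce the tautological isomorphisms … on the associated
rational function monoids".

What this file does (CONSTRUCTIONS over landed inputs; the typed output slots are abc-iut-L6-t4's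
`GlobalLGPFrobenioidSignature.{FMOD, Fmod, Ffrak, isoModMOD, isoModFrak, isoFrakMOD}`, `ThetaPilotObjects.lean`):
* §1 `(†𝕄⊛_MOD)_α` AS PRINTED: the image subring `Prop37.MODField loc α` of the `α`-composite `Prop37.locAt loc α`
  of the localization homomorphism of Prop. 3.3 (abc-iut-L6-t4's `LocalizationHom`, `GlobalPacket.single`), the
  "tautological isomorphism `(†𝕄⊛_mod)_α ⥲ (†𝕄⊛_MOD)_α`" `Prop37.modEquivMOD` (injectivity of the composite), and that
  the image is a field (`Prop37.isField_MODField`).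
* §2 THE INPUT OF EXAMPLE 3.6 FOR A NUMBER FIELD, INTEGRALLY: for `(†𝕄⊛_𝔪𝔬𝔡)_α = F` a number field, the places
  `𝕍 = V(F)` (abc-iut-L1-t3's `Places F`, [FrdI] Ex. 6.3), the value groups `Γ_v = K^×_v/𝒪^×_{K_v}` typed
  FAITHFULLY as `ℤ` at finite and `ℝ` at archimedean places (`Prop37.Gamma`), their cones `Γ_v^{≥0}`
  (`Prop37.nonneg`) and `β_v = ord_v` / `−log |·|_v` (`Prop37.beta`, from abc-iut-L1-t3's `ordFin`); the
  standing hypotheses `ModelHyps` of abc-iut-L6-t6's Frobenioid structure HOLD for this datum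
  (`Prop37.modelHyps`; finite support = abc-iut-L1-t3's `ordFin_finite_support`).
* §3 `(†𝓕⊛_𝔪𝔬𝔡)_α` := abc-iut-L6-t6's category `FrakCat` on that datum (`Prop37.Ffrak F`: objects = genuine
  fractional ideals `λ_v·𝒪_{K_v}` at finite `v`, positive real multiples of `𝒪_{K_v}` at archimedean `v`), the
  tree's `(†𝓕⊛_mod)_α` in [FrdI] Thm. 5.2 model form (`Prop37.FmodModel F` = t6's `FrakModel`), the natural
  isomorphism `(†𝓕⊛_mod)_α ⥲ (†𝓕⊛_𝔪𝔬𝔡)_α` as the EQUIVALENCE `toModel` (unconditional here: `Prop37.toModel_isEquivalence`, `Prop37.isoFrakMod`)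
  and its printed clause "induces the tautological isomorphism on the associated rational function monoids"
  (`Prop37.unit_toModel_map`: every morphism `(n, f)` goes to the model morphism with unit `f`).
* §4 THE DIVISOR DICTIONARY of Ex. 3.6 (ii) ("by associating to an object `𝔍` … the arithmetic line bundle
  obtained from the trivial arithmetic line bundle … by modifying the integral structure … at `v` in the
  fashion prescribed by `𝔍_v`"): the additive isomorphism `Prop37.frakObjEquiv : FrakObj ≃+ ArithDivisor F` with
  abc-iut-L1-t3's arithmetic divisors of [FrdI] Ex. 6.3 (= the divisor group of the tree's `𝓕⊛_mod`,
  abc-iut-L6-t10's `arithFrobenioid`), matching effective families with effective divisors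
  (`Prop37.frakObjEquiv_nonneg_iff`) and principal families `(β_v(f))_v` with principal divisors `div(f)`
  (`Prop37.frakObjEquiv_betaDiv`).

NAMED SLOTS (inputs not landed; no mathematics inlined): the CATEGORY `(†𝓕⊛_MOD)_α` of Ex. 3.6 (i) (torsor
version) is abc-iut-L6-t6's staged `MODCat`; hence the isomorphisms of Frobenioids `(†𝓕⊛_𝔪𝔬𝔡)_α ⥲ (†𝓕⊛_MOD)_α`,
`(†𝓕⊛_mod)_α ⥲ (†𝓕⊛_MOD)_α` are available in the tree only at the object / elementary-morphism level
(abc-iut-L6-t4 `FrakObj.toMOD`, `toMODHom`; abc-iut-L6-t6 `FrakObj.existsUnique_of_elemHom_toMOD`,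
`MODObj.exists_frakObj_iso`), which this file does not restate; the realified version `(†𝓕⊛ℝ_𝔪𝔬𝔡)_α` at
`Γ_v = ℝ` is abc-iut-L6-d1/d3's `ModelFrakObj` with abc-iut-w4-d005's `modelHyps_places`
(`GlobalFrobenioidModelsPlacesHyps.lean`). HONEST SCOPE: record-only typing of the printed construction at
the intended model; nothing here asserts a disputed claim or takes a side on [IUTchIII] Cor. 3.12 (typed ≠
discharged; instantiated ≠ endorsed).
-/

noncomputable section

namespace Literature.IUT.LogThetaLattice

namespace Prop37

open CategoryTheory NumberField GlobalFrobenioidModels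
open Literature.AlgebraicGeometry.Frobenioids (Places ArithDivisor EffArithDivisor ordFin ordFin_mul
  ordFin_finite_support principalArithDivisor)

universe u v w

/-! ### §1 Proposition 3.7 (i): the number field `(†𝕄⊛_MOD)_α` -/

section MODField

open scoped TensorProduct

variable {A : Type v} [Fintype A] [DecidableEq A]
variable (F : A → Type u) [∀ α, Field (F α)] [∀ α, Algebra ℚ (F α)]
variable {VQ : Type w} (P : VQ → Type (max u v)) [∀ vQ, CommRing (P vQ)]

/-- The `α`-composite `(†𝕄⊛_mod)_α → (†𝕄⊛_mod)_A → log(^A𝓕_{𝕍_ℚ})` "of the homomorphisms of Proposition 3.3, (i),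
(ii)" ([IUTchIII] Prop. 3.7 (i), p. 110 l. 2–4; Prop. 3.3 (ii) "tensor product with 1's" followed by the
localization homomorphism of Prop. 3.3 (i)). [claim: Mochizuki2012, status: disputed] -/
def locAt (loc : LocalizationHom F P) (α : A) : F α →+* ∀ vQ, P vQ :=
  loc.toRingHom.comp (GlobalPacket.single F α).toRingHom

/-- **`(†𝕄⊛_MOD)_α`** ([IUTchIII] Prop. 3.7 (i), p. 109 l. 56 – p. 110 l. 1): "the [number] field given by the
image `(†𝕄⊛_MOD)_α` of the composite `(†𝕄⊛_mod)_α → (†𝕄⊛_mod)_A → log(^A𝓕_{𝕍_ℚ})`" — the image subring.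
[claim: Mochizuki2012, status: disputed] -/
def MODField (loc : LocalizationHom F P) (α : A) : Subring (∀ vQ, P vQ) :=
  (locAt F P loc α).range

omit [Fintype A] in
/-- The `α`-composite is injective (injectivity of the localization homomorphism, Prop. 3.3 (i), and of
`(†𝕄⊛_mod)_α → (†𝕄⊛_mod)_A`, Prop. 3.3 (ii) — abc-iut-L6-t5's `GlobalPacket.single_injective`).
[claim: Mochizuki2012, status: disputed] -/
theorem locAt_injective [Nontrivial (GlobalPacket F)] (loc : LocalizationHom F P) (α : A) :
    Function.Injective (locAt F P loc α) :=
  loc.injective.comp (GlobalPacket.single_injective F α)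

/-- **The "tautological isomorphism `(†𝕄⊛_mod)_α ⥲ (†𝕄⊛_MOD)_α`"** ([IUTchIII] Prop. 3.7 (i), p. 110 l. 7–8): the
labelled number field is isomorphic, via the (injective) `α`-composite, to its image.
[claim: Mochizuki2012, status: disputed] -/
def modEquivMOD [Nontrivial (GlobalPacket F)] (loc : LocalizationHom F P) (α : A) :
    F α ≃+* MODField F P loc α :=
  RingEquiv.ofBijective (locAt F P loc α).rangeRestrict
    ⟨fun _ _ h => locAt_injective F P loc α (Subtype.ext_iff.mp h),
      (locAt F P loc α).rangeRestrict_surjective⟩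

omit [Fintype A] in
/-- The tautological isomorphism is the `α`-composite on underlying elements.
[claim: Mochizuki2012, status: disputed] -/
@[simp] theorem coe_modEquivMOD [Nontrivial (GlobalPacket F)] (loc : LocalizationHom F P) (α : A)
    (x : F α) : ((modEquivMOD F P loc α x : MODField F P loc α) : ∀ vQ, P vQ) = locAt F P loc α x :=
  rfl

omit [Fintype A] in
/-- `(†𝕄⊛_MOD)_α` "[is a] [number] field" ([IUTchIII] Prop. 3.7 (i), p. 109 l. 56): the image subring is a
field. [claim: Mochizuki2012, status: disputed] -/
theorem isField_MODField [Nontrivial (GlobalPacket F)] (loc : LocalizationHom F P) (α : A) :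
    IsField (MODField F P loc α) :=
  MulEquiv.isField (Field.toIsField (F α)) (modEquivMOD F P loc α).symm.toMulEquiv

end MODField

/-! ### §2 The Example 3.6 datum of a number field, integrally: `Γ_v = ℤ` (finite), `ℝ` (archimedean) -/

section Places

variable (F : Type) [Field F] [NumberField F]

/-- The value groups `Γ_v = K^×_v / 𝒪^×_{K_v}` of [IUTchIII] Ex. 3.6 (i) (p. 107, "`β_v : F^×_mod → K^×_v/𝒪^×_{K_v}`")
at the places `𝕍 = V(F)` of the number field ([FrdI] Ex. 6.3 p. 112, "`ord(F_v) = F_v^×/𝒪_v^×`", `ℤ` for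
nonarchimedean and `ℝ` for archimedean `v`), written additively. [claim: Mochizuki2012, status: disputed] -/
abbrev Gamma : Places F → Type :=
  Sum.rec (motive := fun _ => Type) (fun _ => ℝ) (fun _ => ℤ)

/-- `Γ_v` is an additive group (`ℝ` resp. `ℤ`). [claim: Mochizuki2012, status: disputed] -/
instance instAddCommGroupGamma (p : Places F) : AddCommGroup (Gamma F p) :=
  Sum.rec (motive := fun p => AddCommGroup (Gamma F p))
    (fun _ => inferInstanceAs (AddCommGroup ℝ)) (fun _ => inferInstanceAs (AddCommGroup ℤ)) p

/-- The cones `Γ_v^{≥0}` = "the image of `𝒪^▷_{K_v}`" ([IUTchIII] Ex. 3.6 (i) p. 107; [FrdI] Ex. 6.3 p. 113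
`ord(𝒪_v^▷) ⊆ ord(F_v)`): `ℝ_{≥0}` resp. `ℤ_{≥0}`. [claim: Mochizuki2012, status: disputed] -/
def nonneg : ∀ p : Places F, AddSubmonoid (Gamma F p)
  | .inl _ => AddSubmonoid.nonneg ℝ
  | .inr _ => AddSubmonoid.nonneg ℤ

/-- Membership in the archimedean cone. [claim: Mochizuki2012, status: disputed] -/
@[simp] theorem mem_nonneg_inl (v : InfinitePlace F) (x : Gamma F (.inl v)) :
    x ∈ nonneg F (.inl v) ↔ (0 : ℝ) ≤ x := Iff.rfl

/-- Membership in the nonarchimedean cone. [claim: Mochizuki2012, status: disputed] -/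
@[simp] theorem mem_nonneg_inr (w : FinitePlace F) (x : Gamma F (.inr w)) :
    x ∈ nonneg F (.inr w) ↔ (0 : ℤ) ≤ x := Iff.rfl

/-- `ord_v(1) = 0`. [cite: MochizukiFrdI2008, Ex. 6.3 p.112] -/
private theorem ordFin_one (w : FinitePlace F) : ordFin F w 1 = 0 := by
  have h := ordFin_mul (F := F) w 1 1
  rw [mul_one] at h
  omega

/-- **`β_v`** ([IUTchIII] Ex. 3.6 (i) p. 107: "the valuation on `K_v` determined by `v` determines a group
homomorphism `β_v : F^×_mod → K^×_v/𝒪^×_{K_v}`"): `−log |·|_v` at an archimedean place, `ord_v` (abc-iut-L1-t3's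
`ordFin`, [FrdI] Ex. 6.3 p. 112) at a finite place. [claim: Mochizuki2012, status: disputed] -/
def beta : ∀ p : Places F, Additive Fˣ →+ Gamma F p
  | .inl v =>
    { toFun := fun f => (-Real.log (v ((Additive.toMul f : Fˣ) : F)) : ℝ)
      map_zero' := by
        show (-Real.log (v ((Additive.toMul (0 : Additive Fˣ) : Fˣ) : F)) : ℝ) = 0
        rw [toMul_zero, Units.val_one, map_one, Real.log_one, neg_zero]
      map_add' := fun f g => by
        show (-Real.log (v (((Additive.toMul (f + g) : Fˣ)) : F)) : ℝ) =
          -Real.log (v ((Additive.toMul f : Fˣ) : F)) + -Real.log (v ((Additive.toMul g : Fˣ) : F))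
        rw [toMul_add, Units.val_mul, map_mul, Real.log_mul (v.pos_iff.mpr (Units.ne_zero _)).ne'
          (v.pos_iff.mpr (Units.ne_zero _)).ne', neg_add] }
  | .inr w =>
    { toFun := fun f => (ordFin F w (Additive.toMul f) : ℤ)
      map_zero' := by
        show ordFin F w (Additive.toMul 0) = 0
        rw [toMul_zero, ordFin_one]
      map_add' := fun f g => by
        show ordFin F w (Additive.toMul (f + g)) = ordFin F w (Additive.toMul f) + ordFin F w (Additive.toMul g)
        rw [toMul_add, ordFin_mul] }

/-- `β_v` at an archimedean place: `−log |f|_v`. [claim: Mochizuki2012, status: disputed] -/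
@[simp] theorem beta_inl (v : InfinitePlace F) (f : Fˣ) :
    beta F (.inl v) (Additive.ofMul f) = (-Real.log (v (f : F)) : ℝ) := rfl

/-- `β_v` at a finite place: `ord_v(f)`. [claim: Mochizuki2012, status: disputed] -/
@[simp] theorem beta_inr (w : FinitePlace F) (f : Fˣ) :
    beta F (.inr w) (Additive.ofMul f) = (ordFin F w f : ℤ) := rfl

/-- `β_v(f) = 0` for all but finitely many places `v` ([IUTchIII] Ex. 3.6 (ii) p. 107 "`𝔍_v = 𝒪_{K_v}` for all but
finitely many `v`"; [FrdI] Ex. 6.3 p. 113 "all but a finite number of which are zero" — abc-iut-L1-t3's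
`ordFin_finite_support`; the archimedean places are finite in number). [claim: Mochizuki2012, status: disputed] -/
theorem finite_beta_ne_zero (f : Fˣ) : {p : Places F | beta F p (Additive.ofMul f) ≠ 0}.Finite := by
  have hfin : {w : FinitePlace F | beta F (.inr w) (Additive.ofMul f) ≠ 0}.Finite :=
    (ordFin_finite_support (F := F) f).subset fun w hw => hw
  have hinf : {v : InfinitePlace F | beta F (.inl v) (Additive.ofMul f) ≠ 0}.Finite := Set.toFinite _
  refine ((hinf.image Sum.inl).union (hfin.image Sum.inr)).subset ?_
  rintro (v | w) h
  · exact Or.inl ⟨v, h, rfl⟩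
  · exact Or.inr ⟨w, h, rfl⟩

/-- **The standing hypotheses `ModelHyps` of abc-iut-L6-t6's Frobenioid structure on `𝓕⊛_𝔪𝔬𝔡` HOLD for the
integral datum of a number field**: `ℝ_{≥0} ⊆ ℝ` and `ℤ_{≥0} ⊆ ℤ` generate, are saturated and sharp, and every
`f ∈ F^×` is a `v`-unit at almost all `v`. ([IUTchIII] Ex. 3.6 (i)(ii) pp. 107–108; Prop. 3.7 (ii) p. 110)
[claim: Mochizuki2012, status: disputed] -/
theorem modelHyps : ModelHyps (F := F) (V := Places F) (Γ := Gamma F) (nonneg F) (beta F) where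
  directed p x := by
    rcases p with v | w
    · change ℝ at x
      refine ⟨(max x 0 : ℝ), ?_, (max (-x) 0 : ℝ), ?_, ?_⟩
      · show (0 : ℝ) ≤ max x 0
        exact le_max_right _ _
      · show (0 : ℝ) ≤ max (-x) 0
        exact le_max_right _ _
      · show x = (max x 0 - max (-x) 0 : ℝ)
        rcases le_total 0 x with h | h
        · rw [max_eq_left h, max_eq_right (neg_nonpos.mpr h), sub_zero]
        · rw [max_eq_right h, max_eq_left (neg_nonneg.mpr h), zero_sub, neg_neg]
    · change ℤ at x
      refine ⟨(max x 0 : ℤ), ?_, (max (-x) 0 : ℤ), ?_, ?_⟩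
      · show (0 : ℤ) ≤ max x 0
        exact le_max_right _ _
      · show (0 : ℤ) ≤ max (-x) 0
        exact le_max_right _ _
      · show x = (max x 0 - max (-x) 0 : ℤ)
        rcases le_total 0 x with h | h
        · rw [max_eq_left h, max_eq_right (neg_nonpos.mpr h), sub_zero]
        · rw [max_eq_right h, max_eq_left (neg_nonneg.mpr h), zero_sub, neg_neg]
  saturated p x n hn hx := by
    rcases p with v | w
    · change ℝ at x
      change (0 : ℝ) ≤ n • x at hx
      show (0 : ℝ) ≤ x
      rw [nsmul_eq_mul] at hx
      exact nonneg_of_mul_nonneg_right hx (Nat.cast_pos.mpr hn)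
    · change ℤ at x
      change (0 : ℤ) ≤ n • x at hx
      show (0 : ℤ) ≤ x
      rw [nsmul_eq_mul] at hx
      exact nonneg_of_mul_nonneg_right hx (Nat.cast_pos.mpr hn)
  sharp p x hx hnx := by
    rcases p with v | w
    · change ℝ at x
      change (0 : ℝ) ≤ x at hx
      change (0 : ℝ) ≤ -x at hnx
      show x = (0 : ℝ)
      linarith
    · change ℤ at x
      change (0 : ℤ) ≤ x at hx
      change (0 : ℤ) ≤ -x at hnx
      show x = (0 : ℤ)
      omega
  finite f := finite_beta_ne_zero F f

/-! ### §3 Proposition 3.7 (ii): `(†𝓕⊛_𝔪𝔬𝔡)_α` and `(†𝓕⊛_mod)_α ⥲ (†𝓕⊛_𝔪𝔬𝔡)_α` -/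

/-- **`(†𝓕⊛_𝔪𝔬𝔡)_α`** ([IUTchIII] Prop. 3.7 (ii), p. 110 l. 29–44), for the number field `(†𝕄⊛_𝔪𝔬𝔡)_α = F`: the
category `𝓕⊛_𝔪𝔬𝔡` of Example 3.6 (ii) (abc-iut-L6-t6's `FrakCat`) on the integral datum of §2 — objects are the
families of local fractional ideals `{𝔍_v = λ_v·𝒪_{K_v}}_v`, almost all trivial (classes `[λ_v] ∈ ℤ` at finite,
`∈ ℝ` at archimedean `v`); morphisms `(n, f)` with `f ∈ F^×` integral for `𝔍₁^{⊗n}`, `𝔍₂`.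
[claim: Mochizuki2012, status: disputed] -/
abbrev Ffrak : Type := FrakCat F (Places F) (Gamma F) (nonneg F) (beta F)

/-- **`(†𝓕⊛_mod)_α` in [FrdI] Thm. 5.2 model form** — the model Frobenioid of the data
(one-arrow base, `Φ` = effective families, `𝔹 = F^×`, `Div_𝔹 = (β_v)_v`) that abc-iut-L6-t6 compares `𝓕⊛_𝔪𝔬𝔡`
with (the tree's form of [IUTchII] Cor. 4.8 (ii)'s `(†𝓕⊛_mod)_j` ← [IUTchI] Ex. 5.1 (iii) ← [FrdI] Ex. 6.3 over the
base object `F_mod`). [claim: Mochizuki2012, status: disputed] -/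
abbrev FmodModel : Type := FrakModel (modelHyps F)

/-- **[IUTchIII] Prop. 3.7 (ii), first isomorphism `(†𝓕⊛_mod)_α ⥲ (†𝓕⊛_𝔪𝔬𝔡)_α`** (p. 110 l. 44–45): abc-iut-L6-t6's
comparison functor `toModel : (†𝓕⊛_𝔪𝔬𝔡)_α ⥤ (†𝓕⊛_mod)_α` IS an equivalence of categories for the integral datum of a
number field — UNCONDITIONALLY, the hypotheses `ModelHyps` being `Prop37.modelHyps`.
[claim: Mochizuki2012, status: disputed] -/
theorem toModel_isEquivalence :
    (toModel (F := F) (V := Places F) (Γ := Gamma F) (nonneg := nonneg F) (β := beta F)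
      (modelHyps F)).IsEquivalence :=
  GlobalFrobenioidModels.toModel_isEquivalence (modelHyps F)

/-- The natural isomorphism `(†𝓕⊛_𝔪𝔬𝔡)_α ≌ (†𝓕⊛_mod)_α` as an equivalence of categories.
[claim: Mochizuki2012, status: disputed] -/
def isoFrakMod : Ffrak F ≌ FmodModel F :=
  haveI := toModel_isEquivalence F
  (toModel (nonneg := nonneg F) (β := beta F) (modelHyps F)).asEquivalence

/-- The functor of `isoFrakMod` is abc-iut-L6-t6's comparison functor `toModel`.
[claim: Mochizuki2012, status: disputed] -/
theorem isoFrakMod_functor :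
    (isoFrakMod F).functor = toModel (nonneg := nonneg F) (β := beta F) (modelHyps F) := rfl

/-- **[IUTchIII] Prop. 3.7 (ii), rational-function clause** (p. 110 l. 46–48: the isomorphisms "induce the
tautological isomorphisms `(†𝕄⊛_mod)_α ⥲ (†𝕄⊛_𝔪𝔬𝔡)_α` … on the associated rational function monoids"; Ex. 3.6 (ii)
p. 108 l. 15–17 "induces the identity morphism `F^×_mod → F^×_mod`"): the equivalence sends every morphism
`(n, f)` of `(†𝓕⊛_𝔪𝔬𝔡)_α` to the model morphism whose unit (rational-function) component is `f` itself.
[claim: Mochizuki2012, status: disputed] -/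
theorem unit_toModel_map {X Y : Ffrak F} (φ : X ⟶ Y) :
    Literature.AlgebraicGeometry.Frobenioids.ModelFrobenioid.unit ((isoFrakMod F).functor.map φ) =
      FrakCat.fn φ :=
  GlobalFrobenioidModels.unit_toModel_map _ φ

/-! ### §4 The divisor dictionary: objects of `(†𝓕⊛_𝔪𝔬𝔡)_α` = arithmetic divisors on `S_mod` ([FrdI] Ex. 6.3) -/

/-- The family of classes of an arithmetic divisor: `(n_w)_w` at the finite places, `(t_v)_v` at the
archimedean ones. [cite: MochizukiFrdI2008, Ex. 6.3 p.113] -/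
def clsOfDivisor (d : ArithDivisor F) : ∀ p : Places F, Gamma F p
  | .inl v => (d.2 v : ℝ)
  | .inr w => (d.1 w : ℤ)

/-- **Example 3.6 (ii)'s dictionary** (p. 108 l. 12–15: "by associating to an object `𝔍 = {𝔍_v}_{v∈𝕍}` … the
arithmetic line bundle on `S_mod` obtained from the trivial arithmetic line bundle … by modifying the integral
structure … at `v ∈ 𝕍` in the fashion prescribed by `𝔍_v`"): families of local fractional ideals of `F`
(objects of `(†𝓕⊛_𝔪𝔬𝔡)_α`) ARE the arithmetic divisors `Φ(F)^gp = ⊕_v ord(F_v)` of [FrdI] Ex. 6.3 (abc-iut-L1-t3's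
`ArithDivisor F`), additively. [claim: Mochizuki2012, status: disputed] -/
def frakObjEquiv : FrakObj (Places F) (Gamma F) ≃+ ArithDivisor F where
  toFun J :=
    (Finsupp.ofSupportFinite (fun w => (J.cls (.inr w) : ℤ))
        (J.finite.preimage Sum.inr_injective.injOn),
      fun v => (J.cls (.inl v) : ℝ))
  invFun d :=
    ⟨clsOfDivisor F d, by
      refine (((Set.toFinite (Set.univ : Set (InfinitePlace F))).image Sum.inl).union
        ((d.1.support.finite_toSet).image Sum.inr)).subset ?_
      rintro (v | w) h
      · exact Or.inl ⟨v, Set.mem_univ _, rfl⟩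
      · exact Or.inr ⟨w, Finset.mem_coe.mpr (Finsupp.mem_support_iff.mpr h), rfl⟩⟩
  left_inv J := by
    refine FrakObj.ext_cls (funext fun p => ?_)
    rcases p with v | w
    · rfl
    · show Finsupp.ofSupportFinite (fun w => (J.cls (.inr w) : ℤ)) _ w = _
      rw [Finsupp.ofSupportFinite_coe]
  right_inv d := by
    refine Prod.ext (Finsupp.ext fun w => ?_) (funext fun v => ?_)
    · rw [Finsupp.ofSupportFinite_coe]
      rfl
    · rfl
  map_add' J₁ J₂ := by
    refine Prod.ext (Finsupp.ext fun w => ?_) (funext fun v => ?_)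
    · rw [Finsupp.ofSupportFinite_coe, Prod.fst_add, Finsupp.coe_add, Pi.add_apply,
        Finsupp.ofSupportFinite_coe, Finsupp.ofSupportFinite_coe]
      rfl
    · rfl

/-- Finite coordinates of the dictionary: the class `[λ_w] ∈ ℤ`. [claim: Mochizuki2012, status: disputed] -/
@[simp] theorem frakObjEquiv_fst (J : FrakObj (Places F) (Gamma F)) (w : FinitePlace F) :
    (frakObjEquiv F J).1 w = J.cls (.inr w) := by
  show Finsupp.ofSupportFinite (fun w => (J.cls (.inr w) : ℤ)) _ w = _
  rw [Finsupp.ofSupportFinite_coe]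

/-- Archimedean coordinates of the dictionary: the class `[λ_v] ∈ ℝ`. [claim: Mochizuki2012, status: disputed] -/
@[simp] theorem frakObjEquiv_snd (J : FrakObj (Places F) (Gamma F)) (v : InfinitePlace F) :
    (frakObjEquiv F J).2 v = J.cls (.inl v) := rfl

/-- Under the dictionary, the EFFECTIVE families (all classes in `Γ_v^{≥0}`; abc-iut-L6-t6's divisor monoid
`effDiv` of the Frobenioid structure of `𝓕⊛_𝔪𝔬𝔡`) are exactly the EFFECTIVE arithmetic divisors `Φ(F)` of [FrdI]
Ex. 6.3 (nonnegative coordinates). [claim: Mochizuki2012, status: disputed] -/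
theorem frakObjEquiv_nonneg_iff (J : FrakObj (Places F) (Gamma F)) :
    (∀ p, J.cls p ∈ nonneg F p) ↔
      (∀ w, 0 ≤ (frakObjEquiv F J).1 w) ∧ ∀ v, 0 ≤ (frakObjEquiv F J).2 v := by
  constructor
  · intro h
    refine ⟨fun w => ?_, fun v => ?_⟩
    · rw [frakObjEquiv_fst]
      exact (mem_nonneg_inr F w _).mp (h (.inr w))
    · rw [frakObjEquiv_snd]
      exact (mem_nonneg_inl F v _).mp (h (.inl v))
  · rintro ⟨h₁, h₂⟩ (v | w)
    · exact (mem_nonneg_inl F v _).mpr (frakObjEquiv_snd F J v ▸ h₂ v)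
    · exact (mem_nonneg_inr F w _).mpr (frakObjEquiv_fst F J w ▸ h₁ w)

/-- Under the dictionary, the principal family `(β_v(f))_v` of `f ∈ F^×` (abc-iut-L6-t6's `betaDiv`, the
`Div_𝔹` of the model Frobenioid) is the principal arithmetic divisor `div(f) = ((ord_v f)_v, (−log|f|_v)_v)` of
[FrdI] Ex. 6.3 (abc-iut-L1-t3's `principalArithDivisor`). [claim: Mochizuki2012, status: disputed] -/
theorem frakObjEquiv_betaDiv (f : Fˣ) :
    frakObjEquiv F (Multiplicative.toAdd (betaDiv (modelHyps F) f)) = principalArithDivisor F f := by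
  refine Prod.ext (Finsupp.ext fun w => ?_) (funext fun v => ?_)
  · rw [frakObjEquiv_fst, cls_betaDiv, beta_inr, Literature.AlgebraicGeometry.Frobenioids.principalArithDivisor_fst]
  · rw [frakObjEquiv_snd, cls_betaDiv, beta_inl, Literature.AlgebraicGeometry.Frobenioids.principalArithDivisor_snd]

end Places

end Prop37

end Literature.IUT.LogThetaLattice

end
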